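import Literature.Computability.Cryptography.ShorPerfectPowerFP
import Literature.Computability.Cryptography.ShorReplay
import Literature.Computability.Complexity.StackBricksStrings
import Literature.Computability.Complexity.StackBricksLists
import Literature.Computability.Complexity.StackBricksItems
import HarnessLib

/-!
# One round of the replay of Shor's classical driver as an `FP` string function

Family `PQC`; companion of `ShorReplay.lean` (`wstepR`: one round of the work-list machine
threaded with the recorded oracle answers) on the way to `Shor1997.shorComp_isPolyTime`. The
machine computing the step function of `shorComp` keeps a **record**

`⟨x, ⟨coins, ⟨answers, ⟨todoN, ⟨todoB, ⟨done, status⟩⟩⟩⟩⟩⟩`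

(`x` the input numeral string — the attempt budget `T = 32(|x|+1)` is recomputed from it —, the
unread coins,
the code `encList` of the unread answers, the codes of the numerals / budgets of the work list,
the code of the numbers declared prime, and the status `[]` = running / `1 :: q` = stuck with
pending query `q`) and advances it by one round with the `FP` string function `roundF`, written
in the brick algebra (`BrickAlgebra.lean`) over the bricks of `StackBricks*.lean` and
`ShorPerfectPowerFP.ppF`:

* `roundF` and `roundF_mem_FP`;
* `fstF_roundF` (the first field is kept) and `length_roundF_le` (growth `≤ c (|x| + 1)` per round
  on **every** string — budgets are the only instance-size data added; the pending query is
  written only under the cap `|m| ≤ |x| + 1`, true of every divisor of `n`), the hypotheses of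
  `IterateFPGrowth.iterate_mem_FP_of_growth`;
* `recOf` (the record of a replay configuration) and **`roundF_recOf`**: on the record of a
  well-formed configuration `roundF` realises `Shor1997.wstepR` with the block value read off the
  next `|x| + 1` coins.

## References

* P. W. Shor, SIAM J. Comput. 26 (1997) 1484–1509, §5 pp.15–16.
* S. Arora, B. Barak, *Computational Complexity*, CUP 2009, §1.3, §3.4.
-/

noncomputable section

namespace Literature.Computability.Cryptography

namespace ShorFP

open _root_.Computability Polynomial Complexity Complexity.Brick Shor1997

-- keep `List.takeD (n + 1)` folded in statements about coin blocks, and the field abbreviations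
-- (`nthF 0`, `sndPow 0`) syntactically stable under `simp`
attribute [-simp] List.takeD_succ Brick.nthF_zero Brick.sndPow_zero

/-! ### The record and its fields -/

/-- The seven-field record. [folklore] -/
def rec7 (x co as tn tb dn st : List Bool) : List Bool :=
  boolPair x (boolPair co (boolPair as (boolPair tn (boolPair tb (boolPair dn st)))))

/-- Field `x`. [folklore] -/
abbrev xF : List Bool → List Bool := nthF 0
/-- Field `coins`. [folklore] -/
abbrev coF : List Bool → List Bool := nthF 1
/-- Field `answers`. [folklore] -/
abbrev asF : List Bool → List Bool := nthF 2
/-- Field `todoN`. [folklore] -/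
abbrev tnF : List Bool → List Bool := nthF 3
/-- Field `todoB`. [folklore] -/
abbrev tbF : List Bool → List Bool := nthF 4
/-- Field `done`. [folklore] -/
abbrev dnF : List Bool → List Bool := nthF 5
/-- Field `status`. [folklore] -/
abbrev stF : List Bool → List Bool := sndPow 5

/-- The attempt budget `T = 32 (|x| + 1)` as a numeral, recomputed from `x` (never copied from
the record, so that malformed records cannot inflate it). [folklore] -/
def budgetF : List Bool → List Bool := lenBinF ∘ onesMulFn 32 ∘ List.cons true ∘ xF

/-- `budgetF` evaluates to `encodeNat (budget |x|)` (`Shor1997.budget L = 32 (L + 1)`). [folklore] -/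
theorem budgetF_eq (z : List Bool) : budgetF z = encodeNat (budget (xF z).length) := by
  simp [budgetF, onesMulFn, budget]

/-- `budgetF ∈ FP`. [folklore] -/
theorem budgetF_mem_FP : budgetF ∈ FP :=
  comp_mem_FP lenBinF_mem_FP (comp_mem_FP (onesMulFn_mem_FP 32) (comp_mem_FP (cons_mem_FP true) (nthF_mem_FP 0)))


attribute [simp] rec7

/-- Assembling a record from seven field functions. [folklore] -/
def mk7 (a b c d e f g : List Bool → List Bool) : List Bool → List Bool :=
  fanoutFn a (fanoutFn b (fanoutFn c (fanoutFn d (fanoutFn e (fanoutFn f g)))))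

/-- `mk7` applied. [folklore] -/
@[simp] theorem mk7_apply (a b c d e f g : List Bool → List Bool) (z : List Bool) :
    mk7 a b c d e f g z = rec7 (a z) (b z) (c z) (d z) (e z) (f z) (g z) := by
  simp [mk7, rec7]

/-- `mk7` of `FP` functions is in `FP`. [folklore] -/
theorem mk7_mem_FP {a b c d e f g : List Bool → List Bool} (ha : a ∈ FP) (hb : b ∈ FP) (hc : c ∈ FP) (hd : d ∈ FP)
    (he : e ∈ FP) (hf : f ∈ FP) (hg : g ∈ FP) : mk7 a b c d e f g ∈ FP :=
  fanoutFn_mem_FP ha (fanoutFn_mem_FP hb (fanoutFn_mem_FP hc (fanoutFn_mem_FP hd (fanoutFn_mem_FP he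
    (fanoutFn_mem_FP hf hg)))))

/-- The two-element constant numeral `2 = [0, 1]`. [folklore] -/
def twoF : List Bool → List Bool := fun _ => [false, true]

/-- Pairing two field functions. [folklore] -/
abbrev pr (f g : List Bool → List Bool) : List Bool → List Bool := fanoutFn f g

/-! ### The data of one round -/

/-- The next coin block (width `|x| + 1`) and the rest: `⟨block, rest⟩`. [folklore] -/
def blkF : List Bool → List Bool := padTakeFn ∘ pr (List.cons true ∘ xF) coF
/-- The block. [folklore] -/
def blockF : List Bool → List Bool := fstF ∘ blkF
/-- The remaining coins. [folklore] -/
def co'F : List Bool → List Bool := sndF ∘ blkF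

/-- The number at the top of the work list and the rest; its budget and the rest. [folklore] -/
def mF : List Bool → List Bool := fstF ∘ tnF
/-- Rest of the numerals. [folklore] -/
def restF : List Bool → List Bool := sndF ∘ tnF
/-- The budget of the top. [folklore] -/
def kF : List Bool → List Bool := fstF ∘ tbF
/-- Rest of the budgets. [folklore] -/
def restBF : List Bool → List Bool := sndF ∘ tbF

/-- The candidate unit `X mod 2^{size m}`: the low `|m|` bits of the block. [folklore] -/
def xlF : List Bool → List Bool := lowBitsFn ∘ pr mF blockF
/-- `gcd (X mod 2^size m) m`. [folklore] -/
def gF : List Bool → List Bool := gcdFn ∘ pr xlF mF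
/-- The perfect-power data `⟨bit, base⟩` of `m`. [folklore] -/
def ppDF : List Bool → List Bool := ppF ∘ mF
/-- The answers block: `⟨[ok], ⟨payload, answers'⟩⟩` for `|m|` answers. [folklore] -/
def obF : List Bool → List Bool := takeItemsFn ∘ pr mF asF
/-- The order numeral (or the count). [folklore] -/
def rOrIdxF : List Bool → List Bool := fstF ∘ sndF ∘ obF
/-- The remaining answers after the block. [folklore] -/
def as'F : List Bool → List Bool := sndF ∘ sndF ∘ obF
/-- `r / 2`. [folklore] -/
def halfF : List Bool → List Bool := divFn ∘ pr rOrIdxF twoF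
/-- `y = x ^ (r/2) mod m`. [folklore] -/
def yF : List Bool → List Bool := modExpFn ∘ pr xlF (pr halfF mF)
/-- `y - 1 mod m` as the representative `m - 1` (if `y = 0`) or `y - 1`. [folklore] -/
def ym1F : List Bool → List Bool := iteFn (isNilFn ∘ yF) (predF ∘ mF) (predF ∘ yF)
/-- Shor's divisor `gcd (x^{r/2} - 1, m)`. [folklore] -/
def d3F : List Bool → List Bool := gcdFn ∘ pr ym1F mF
/-- `m / d` for a divisor field `d`. [folklore] -/
def quoF (d : List Bool → List Bool) : List Bool → List Bool := divFn ∘ pr mF d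

/-! ### Conditions (one-bit on every input) -/

/-- Equality of numerals by value: neither is smaller. [folklore] -/
def eqValF (f g : List Bool → List Bool) : List Bool → List Bool :=
  andFn (notFn (ltFn ∘ pr f g)) (notFn (ltFn ∘ pr g f))

/-- `m` even. [folklore] -/
def cEven : List Bool → List Bool := parityFn ∘ mF
/-- `m = 2`. [folklore] -/
def cTwo : List Bool → List Bool := eqValF mF twoF
/-- `ppBase m < m`. [folklore] -/
def cPP : List Bool → List Bool := fstF ∘ ppDF
/-- `x = 0 ∨ m ≤ x` (a failed draw). [folklore] -/
def cBad : List Bool → List Bool := iteFn (isNilFn ∘ xlF) (fun _ => [true]) (notFn (ltFn ∘ pr xlF mF))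
/-- `1 < gcd`. [folklore] -/
def cG : List Bool → List Bool := valGeTwoFn ∘ gF
/-- enough answers. [folklore] -/
def cOk : List Bool → List Bool := fstF ∘ obF
/-- Shor's criterion `Even r ∧ ¬ m ∣ x^{r/2} + 1`. [folklore] -/
def cShor : List Bool → List Bool := andFn (parityFn ∘ rOrIdxF) (notFn (eqValF (succF ∘ yF) mF))
/-- `k ≤ 1` (last attempt). [folklore] -/
def cLast : List Bool → List Bool := notFn (valGeTwoFn ∘ kF)
/-- stuck already. [folklore] -/
def cRun : List Bool → List Bool := isNilFn ∘ stF
/-- work list empty. [folklore] -/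
def cIdle : List Bool → List Bool := isNilFn ∘ tnF
/-- the cap `|m| ≤ |x| + 1` under which the pending query is written. [folklore] -/
def cCap : List Bool → List Bool := lenLeFn (X + 1) ∘ pr xF mF

/-! ### The outcomes as records -/

/-- Split `m` by the divisor `d`: push `d` and `m/d` with fresh budgets; answers by `A`. [folklore] -/
def splitR (d A : List Bool → List Bool) : List Bool → List Bool :=
  mk7 xF co'F A (pr d (pr (quoF d) restF)) (pr budgetF (pr budgetF restBF)) dnF (fun _ => [])
/-- A failed attempt: decrement the budget, or declare `m` prime after the last one; answers by `A`.
[folklore] -/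
def failR (A : List Bool → List Bool) : List Bool → List Bool :=
  iteFn cLast (mk7 xF co'F A restF restBF (pr mF dnF) (fun _ => []))
    (mk7 xF co'F A (pr mF restF) (pr (predF ∘ kF) restBF) dnF (fun _ => []))
/-- Stuck: record the pending query `⟨⟨x, m⟩, index⟩` (under the cap; else a bare mark). [folklore] -/
def stuckR : List Bool → List Bool :=
  mk7 xF co'F asF tnF tbF dnF (iteFn cCap (List.cons true ∘ pr (pr xlF mF) rOrIdxF) (fun _ => [true]))
/-- An idle round (empty work list): only the coins move. [folklore] -/
def idleR : List Bool → List Bool := mk7 xF co'F asF tnF tbF dnF stF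
/-- A round of a stuck record: nothing moves (the record is reassembled). [folklore] -/
def sameR : List Bool → List Bool := mk7 xF coF asF tnF tbF dnF stF

/-- **One round**: the case distinction of `Shor1997.splitStepR` / `wstepR`. [cite: Shor1997SICOMP, §5 p.16 (reduction of factoring to order finding)] -/
def roundF : List Bool → List Bool :=
  iteFn cRun
    (iteFn cIdle idleR
      (iteFn cEven (iteFn cTwo (failR asF) (splitR twoF asF))
        (iteFn cPP (splitR (sndF ∘ ppDF) asF)
          (iteFn cBad (failR asF)
            (iteFn cG (splitR gF asF)
              (iteFn cOk (iteFn cShor (splitR d3F as'F) (failR as'F))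
                stuckR))))))
    sameR

/-! ### Membership in `FP` -/

/-- `twoF_mem_FP`: membership / evaluation rule. [folklore] -/
theorem twoF_mem_FP : twoF ∈ FP := const_mem_FP _
/-- `blkF_mem_FP`: membership / evaluation rule. [folklore] -/
theorem blkF_mem_FP : blkF ∈ FP :=
  comp_mem_FP padTakeFn_mem_FP (fanoutFn_mem_FP (comp_mem_FP (cons_mem_FP true) (nthF_mem_FP 0)) (nthF_mem_FP 1))
/-- `blockF_mem_FP`: membership / evaluation rule. [folklore] -/
theorem blockF_mem_FP : blockF ∈ FP := comp_mem_FP fstF_mem_FP blkF_mem_FP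
/-- `co'F_mem_FP`: membership / evaluation rule. [folklore] -/
theorem co'F_mem_FP : co'F ∈ FP := comp_mem_FP sndF_mem_FP blkF_mem_FP
/-- `mF_mem_FP`: membership / evaluation rule. [folklore] -/
theorem mF_mem_FP : mF ∈ FP := comp_mem_FP fstF_mem_FP (nthF_mem_FP 3)
/-- `restF_mem_FP`: membership / evaluation rule. [folklore] -/
theorem restF_mem_FP : restF ∈ FP := comp_mem_FP sndF_mem_FP (nthF_mem_FP 3)
/-- `kF_mem_FP`: membership / evaluation rule. [folklore] -/
theorem kF_mem_FP : kF ∈ FP := comp_mem_FP fstF_mem_FP (nthF_mem_FP 4)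
/-- `restBF_mem_FP`: membership / evaluation rule. [folklore] -/
theorem restBF_mem_FP : restBF ∈ FP := comp_mem_FP sndF_mem_FP (nthF_mem_FP 4)
/-- `xlF_mem_FP`: membership / evaluation rule. [folklore] -/
theorem xlF_mem_FP : xlF ∈ FP := comp_mem_FP lowBitsFn_mem_FP (fanoutFn_mem_FP mF_mem_FP blockF_mem_FP)
/-- `gF_mem_FP`: membership / evaluation rule. [folklore] -/
theorem gF_mem_FP : gF ∈ FP := comp_mem_FP gcdFn_mem_FP (fanoutFn_mem_FP xlF_mem_FP mF_mem_FP)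
/-- `ppDF_mem_FP`: membership / evaluation rule. [folklore] -/
theorem ppDF_mem_FP : ppDF ∈ FP := comp_mem_FP ppF_mem_FP mF_mem_FP
/-- `obF_mem_FP`: membership / evaluation rule. [folklore] -/
theorem obF_mem_FP : obF ∈ FP := comp_mem_FP takeItemsFn_mem_FP (fanoutFn_mem_FP mF_mem_FP (nthF_mem_FP 2))
/-- `rOrIdxF_mem_FP`: membership / evaluation rule. [folklore] -/
theorem rOrIdxF_mem_FP : rOrIdxF ∈ FP := comp_mem_FP fstF_mem_FP (comp_mem_FP sndF_mem_FP obF_mem_FP)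
/-- `as'F_mem_FP`: membership / evaluation rule. [folklore] -/
theorem as'F_mem_FP : as'F ∈ FP := comp_mem_FP sndF_mem_FP (comp_mem_FP sndF_mem_FP obF_mem_FP)
/-- `halfF_mem_FP`: membership / evaluation rule. [folklore] -/
theorem halfF_mem_FP : halfF ∈ FP := comp_mem_FP divFn_mem_FP (fanoutFn_mem_FP rOrIdxF_mem_FP twoF_mem_FP)
/-- `yF_mem_FP`: membership / evaluation rule. [folklore] -/
theorem yF_mem_FP : yF ∈ FP := comp_mem_FP modExpFn_mem_FP (fanoutFn_mem_FP xlF_mem_FP (fanoutFn_mem_FP halfF_mem_FP mF_mem_FP))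
/-- `ym1F_mem_FP`: membership / evaluation rule. [folklore] -/
theorem ym1F_mem_FP : ym1F ∈ FP :=
  iteFn_mem_FP (comp_mem_FP isNilFn_mem_FP yF_mem_FP) (comp_mem_FP predF_mem_FP mF_mem_FP) (comp_mem_FP predF_mem_FP yF_mem_FP)
/-- `d3F_mem_FP`: membership / evaluation rule. [folklore] -/
theorem d3F_mem_FP : d3F ∈ FP := comp_mem_FP gcdFn_mem_FP (fanoutFn_mem_FP ym1F_mem_FP mF_mem_FP)
/-- `quoF_mem_FP`: membership / evaluation rule. [folklore] -/
theorem quoF_mem_FP {d : List Bool → List Bool} (hd : d ∈ FP) : quoF d ∈ FP := comp_mem_FP divFn_mem_FP (fanoutFn_mem_FP mF_mem_FP hd)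
/-- `eqValF_mem_FP`: membership / evaluation rule. [folklore] -/
theorem eqValF_mem_FP {f g : List Bool → List Bool} (hf : f ∈ FP) (hg : g ∈ FP) : eqValF f g ∈ FP :=
  andFn_mem_FP (notFn_mem_FP (comp_mem_FP ltFn_mem_FP (fanoutFn_mem_FP hf hg)))
    (notFn_mem_FP (comp_mem_FP ltFn_mem_FP (fanoutFn_mem_FP hg hf)))
/-- `cEven_mem_FP`: membership / evaluation rule. [folklore] -/
theorem cEven_mem_FP : cEven ∈ FP := comp_mem_FP parityFn_mem_FP mF_mem_FP
/-- `cTwo_mem_FP`: membership / evaluation rule. [folklore] -/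
theorem cTwo_mem_FP : cTwo ∈ FP := eqValF_mem_FP mF_mem_FP twoF_mem_FP
/-- `cPP_mem_FP`: membership / evaluation rule. [folklore] -/
theorem cPP_mem_FP : cPP ∈ FP := comp_mem_FP fstF_mem_FP ppDF_mem_FP
/-- `cBad_mem_FP`: membership / evaluation rule. [folklore] -/
theorem cBad_mem_FP : cBad ∈ FP :=
  iteFn_mem_FP (comp_mem_FP isNilFn_mem_FP xlF_mem_FP) (const_mem_FP _) (notFn_mem_FP (comp_mem_FP ltFn_mem_FP (fanoutFn_mem_FP xlF_mem_FP mF_mem_FP)))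
/-- `cG_mem_FP`: membership / evaluation rule. [folklore] -/
theorem cG_mem_FP : cG ∈ FP := comp_mem_FP valGeTwoFn_mem_FP gF_mem_FP
/-- `cOk_mem_FP`: membership / evaluation rule. [folklore] -/
theorem cOk_mem_FP : cOk ∈ FP := comp_mem_FP fstF_mem_FP obF_mem_FP
/-- `cShor_mem_FP`: membership / evaluation rule. [folklore] -/
theorem cShor_mem_FP : cShor ∈ FP :=
  andFn_mem_FP (comp_mem_FP parityFn_mem_FP rOrIdxF_mem_FP) (notFn_mem_FP (eqValF_mem_FP (comp_mem_FP succF_mem_FP yF_mem_FP) mF_mem_FP))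
/-- `cLast_mem_FP`: membership / evaluation rule. [folklore] -/
theorem cLast_mem_FP : cLast ∈ FP := notFn_mem_FP (comp_mem_FP valGeTwoFn_mem_FP kF_mem_FP)
/-- `cRun_mem_FP`: membership / evaluation rule. [folklore] -/
theorem cRun_mem_FP : cRun ∈ FP := comp_mem_FP isNilFn_mem_FP (sndPow_mem_FP 5)
/-- `cIdle_mem_FP`: membership / evaluation rule. [folklore] -/
theorem cIdle_mem_FP : cIdle ∈ FP := comp_mem_FP isNilFn_mem_FP (nthF_mem_FP 3)
/-- `cCap_mem_FP`: membership / evaluation rule. [folklore] -/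
theorem cCap_mem_FP : cCap ∈ FP := comp_mem_FP (lenLeFn_mem_FP _) (fanoutFn_mem_FP (nthF_mem_FP 0) mF_mem_FP)

/-- `splitR_mem_FP`: membership / evaluation rule. [folklore] -/
theorem splitR_mem_FP {d A : List Bool → List Bool} (hd : d ∈ FP) (hA : A ∈ FP) : splitR d A ∈ FP :=
  mk7_mem_FP (nthF_mem_FP 0) co'F_mem_FP hA (fanoutFn_mem_FP hd (fanoutFn_mem_FP (quoF_mem_FP hd) restF_mem_FP))
    (fanoutFn_mem_FP budgetF_mem_FP (fanoutFn_mem_FP budgetF_mem_FP restBF_mem_FP)) (nthF_mem_FP 5) (const_mem_FP _)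
/-- `failR_mem_FP`: membership / evaluation rule. [folklore] -/
theorem failR_mem_FP {A : List Bool → List Bool} (hA : A ∈ FP) : failR A ∈ FP :=
  iteFn_mem_FP cLast_mem_FP
    (mk7_mem_FP (nthF_mem_FP 0) co'F_mem_FP hA restF_mem_FP restBF_mem_FP (fanoutFn_mem_FP mF_mem_FP (nthF_mem_FP 5)) (const_mem_FP _))
    (mk7_mem_FP (nthF_mem_FP 0) co'F_mem_FP hA (fanoutFn_mem_FP mF_mem_FP restF_mem_FP)
      (fanoutFn_mem_FP (comp_mem_FP predF_mem_FP kF_mem_FP) restBF_mem_FP) (nthF_mem_FP 5) (const_mem_FP _))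
/-- `stuckR_mem_FP`: membership / evaluation rule. [folklore] -/
theorem stuckR_mem_FP : stuckR ∈ FP :=
  mk7_mem_FP (nthF_mem_FP 0) co'F_mem_FP (nthF_mem_FP 2) (nthF_mem_FP 3) (nthF_mem_FP 4) (nthF_mem_FP 5)
    (iteFn_mem_FP cCap_mem_FP (comp_mem_FP (cons_mem_FP true) (fanoutFn_mem_FP (fanoutFn_mem_FP xlF_mem_FP mF_mem_FP) rOrIdxF_mem_FP)) (const_mem_FP _))
/-- `idleR_mem_FP`: membership / evaluation rule. [folklore] -/
theorem idleR_mem_FP : idleR ∈ FP :=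
  mk7_mem_FP (nthF_mem_FP 0) co'F_mem_FP (nthF_mem_FP 2) (nthF_mem_FP 3) (nthF_mem_FP 4) (nthF_mem_FP 5) (sndPow_mem_FP 5)
/-- `sameR_mem_FP`: membership / evaluation rule. [folklore] -/
theorem sameR_mem_FP : sameR ∈ FP :=
  mk7_mem_FP (nthF_mem_FP 0) (nthF_mem_FP 1) (nthF_mem_FP 2) (nthF_mem_FP 3) (nthF_mem_FP 4) (nthF_mem_FP 5) (sndPow_mem_FP 5)

/-- **`roundF ∈ FP`.** [cite: AroraBarak2009, §1.3 (closure of polynomial time under composition)] -/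
theorem roundF_mem_FP : roundF ∈ FP :=
  iteFn_mem_FP cRun_mem_FP
    (iteFn_mem_FP cIdle_mem_FP idleR_mem_FP
      (iteFn_mem_FP cEven_mem_FP (iteFn_mem_FP cTwo_mem_FP (failR_mem_FP (nthF_mem_FP 2)) (splitR_mem_FP twoF_mem_FP (nthF_mem_FP 2)))
        (iteFn_mem_FP cPP_mem_FP (splitR_mem_FP (comp_mem_FP sndF_mem_FP ppDF_mem_FP) (nthF_mem_FP 2))
          (iteFn_mem_FP cBad_mem_FP (failR_mem_FP (nthF_mem_FP 2))
            (iteFn_mem_FP cG_mem_FP (splitR_mem_FP gF_mem_FP (nthF_mem_FP 2))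
              (iteFn_mem_FP cOk_mem_FP (iteFn_mem_FP cShor_mem_FP (splitR_mem_FP d3F_mem_FP as'F_mem_FP) (failR_mem_FP as'F_mem_FP))
                stuckR_mem_FP))))))
    sameR_mem_FP

/-! ### The record of a replay configuration -/

/-- The record of a configuration: input numeral string `x`, budget `T`, unread coins `c`,
unread answers `as`, work list `todo` (numbers with their budgets), numbers declared prime
`done`, status `st`. [folklore] -/
def recOf (x : List Bool) (c : List Bool) (as : List (List Bool)) (todo : List (ℕ × ℕ)) (done : List ℕ) (st : List Bool) : List Bool :=
  rec7 x c (encList as) (encList (todo.map fun p => encodeNat p.1)) (encList (todo.map fun p => encodeNat p.2))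
    (encList (done.map encodeNat)) st


section Eval

variable (x : List Bool) (c : List Bool) (as : List (List Bool)) (m k : ℕ) (rest : List (ℕ × ℕ)) (done : List ℕ) (st : List Bool)

/-- Abbreviation of the generic nonempty-work-list record in this section. [folklore] -/
local notation "ρ" => recOf x c as ((m, k) :: rest) done st

/-- The block value read off the next `|x| + 1` coins. [folklore] -/
def blockVal (x c : List Bool) : ℕ := bitsToNat (List.takeD (x.length + 1) c false)

/-- Field `x` of a record. [folklore] -/
@[simp] theorem xF_recOf (todo : List (ℕ × ℕ)) : xF (recOf x c as todo done st) = x := by simp [recOf]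
/-- The coins of a record. [folklore] -/
@[simp] theorem coF_recOf (todo : List (ℕ × ℕ)) : coF (recOf x c as todo done st) = c := by simp [recOf]
/-- The answers of a record. [folklore] -/
@[simp] theorem asF_recOf (todo : List (ℕ × ℕ)) : asF (recOf x c as todo done st) = encList as := by simp [recOf]
/-- The work-list numbers of a record. [folklore] -/
@[simp] theorem tnF_recOf (todo : List (ℕ × ℕ)) : tnF (recOf x c as todo done st) = encList (todo.map fun p => encodeNat p.1) := by simp [recOf]
/-- The work-list budgets of a record. [folklore] -/
@[simp] theorem tbF_recOf (todo : List (ℕ × ℕ)) : tbF (recOf x c as todo done st) = encList (todo.map fun p => encodeNat p.2) := by simp [recOf]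
/-- The numbers declared prime, on a record. [folklore] -/
@[simp] theorem dnF_recOf (todo : List (ℕ × ℕ)) : dnF (recOf x c as todo done st) = encList (done.map encodeNat) := by simp [recOf]
/-- The status of a record. [folklore] -/
@[simp] theorem stF_recOf (todo : List (ℕ × ℕ)) : stF (recOf x c as todo done st) = st := by simp [recOf]

/-- The next coin block and the remaining coins. [folklore] -/
@[simp] theorem blkF_recOf (todo : List (ℕ × ℕ)) :
    blkF (recOf x c as todo done st) = boolPair (List.takeD (x.length + 1) c false) (c.drop (x.length + 1)) := by
  simp [blkF]
/-- The next coin block. [folklore] -/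
@[simp] theorem blockF_recOf (todo : List (ℕ × ℕ)) : blockF (recOf x c as todo done st) = List.takeD (x.length + 1) c false := by
  simp [blockF]
/-- The coins after the next block. [folklore] -/
@[simp] theorem co'F_recOf (todo : List (ℕ × ℕ)) : co'F (recOf x c as todo done st) = c.drop (x.length + 1) := by
  simp [co'F]

/-- The top number of the work list. [folklore] -/
@[simp] theorem mF_recOf : mF ρ = encodeNat m := by simp [mF, encList_cons]
/-- The numbers below the top of the work list. [folklore] -/
@[simp] theorem restF_recOf : restF ρ = encList (rest.map fun p => encodeNat p.1) := by simp [restF, encList_cons]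
/-- The budget of the top number. [folklore] -/
@[simp] theorem kF_recOf : kF ρ = encodeNat k := by simp [kF, encList_cons]
/-- The budgets below the top of the work list. [folklore] -/
@[simp] theorem restBF_recOf : restBF ρ = encList (rest.map fun p => encodeNat p.2) := by simp [restBF, encList_cons]

/-- The candidate unit is `X mod 2^{size m}`. [folklore] -/
@[simp] theorem xlF_recOf : xlF ρ = encodeNat (blockVal x c % 2 ^ m.size) := by
  simp [xlF, TM2Pass.length_encodeNat_eq_size, blockVal, norm_eq_encodeNat, bitsToNat_take]

/-- The gcd of the candidate unit with the top number. [folklore] -/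
@[simp] theorem gF_recOf : gF ρ = encodeNat (Nat.gcd (blockVal x c % 2 ^ m.size) m) := by simp [gF]

/-- The perfect-power data of `m ≥ 2`. [folklore] -/
theorem ppDF_recOf (hm : 2 ≤ m) : ppDF ρ = boolPair [decide (ppBase m < m)] (if ppBase m < m then encodeNat (ppBase m) else []) := by
  simp [ppDF, ppF_encodeNat hm]

/-- The answer block when enough answers are recorded. [folklore] -/
theorem obF_recOf_of_le (h : m.size ≤ as.length) :
    obF ρ = boolPair [true] (boolPair (encodeNat (ofAnswerBits (as.take m.size))) (encList (as.drop m.size))) := by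
  have hu : (encodeNat m).length ≤ as.length := by rwa [TM2Pass.length_encodeNat_eq_size]
  simp only [obF, Function.comp_apply, fanoutFn_apply, mF_recOf, asF_recOf, takeItemsFn_encList_of_le hu,
    TM2Pass.length_encodeNat_eq_size]
  congr 2
  rw [norm_eq_encodeNat]
  congr 1
  -- the bits assemble the number `ofAnswerBits`
  generalize as.take m.size = l
  unfold ofAnswerBits
  induction l with
  | nil => rfl
  | cons a l ih => simp [Nat.ofDigits_cons, ih]

/-- The answer block when too few answers are recorded. [folklore] -/
theorem obF_recOf_of_lt (h : as.length < m.size) : obF ρ = boolPair [false] (boolPair (encodeNat as.length) []) := by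
  have hu : as.length < (encodeNat m).length := by rwa [TM2Pass.length_encodeNat_eq_size]
  simp only [obF, Function.comp_apply, fanoutFn_apply, mF_recOf, asF_recOf, takeItemsFn_encList_of_lt hu]

/-- The order numeral. [folklore] -/
theorem rOrIdxF_recOf_of_le (h : m.size ≤ as.length) : rOrIdxF ρ = encodeNat (ofAnswerBits (as.take m.size)) := by
  simp [rOrIdxF, obF_recOf_of_le x c as m k rest done st h]

/-- The count, when stuck. [folklore] -/
theorem rOrIdxF_recOf_of_lt (h : as.length < m.size) : rOrIdxF ρ = encodeNat as.length := by
  simp [rOrIdxF, obF_recOf_of_lt x c as m k rest done st h]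

/-- The remaining answers. [folklore] -/
theorem as'F_recOf_of_le (h : m.size ≤ as.length) : as'F ρ = encList (as.drop m.size) := by
  simp [as'F, obF_recOf_of_le x c as m k rest done st h]

/-- `r / 2`. [folklore] -/
theorem halfF_recOf_of_le (h : m.size ≤ as.length) : halfF ρ = encodeNat (ofAnswerBits (as.take m.size) / 2) := by
  simp [halfF, twoF, rOrIdxF_recOf_of_le x c as m k rest done st h]

/-- `y = x^{r/2} mod m` (`m ≥ 2`). [folklore] -/
theorem yF_recOf_of_le (hm : 2 ≤ m) (h : m.size ≤ as.length) :
    yF ρ = encodeNat ((blockVal x c % 2 ^ m.size) ^ (ofAnswerBits (as.take m.size) / 2) % m) := by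
  simp only [yF, Function.comp_apply, fanoutFn_apply, xlF_recOf, halfF_recOf_of_le x c as m k rest done st h, mF_recOf]
  rw [modExpFn_boolPair (by simpa using hm)]
  simp

/-- The representative of `x^{r/2} - 1` modulo `m`. [folklore] -/
theorem ym1F_recOf_of_le (hm : 2 ≤ m) (h : m.size ≤ as.length) :
    ym1F ρ = encodeNat (let y := (blockVal x c % 2 ^ m.size) ^ (ofAnswerBits (as.take m.size) / 2) % m; if y = 0 then m - 1 else y - 1) := by
  have hy := yF_recOf_of_le x c as m k rest done st hm h
  set y := (blockVal x c % 2 ^ m.size) ^ (ofAnswerBits (as.take m.size) / 2) % m with hydef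
  by_cases h0 : y = 0
  · rw [ym1F, iteFn_apply_true (by simp [hy, h0, isNilFn]; rfl)]
    simp [h0]
  · have hne : encodeNat y ≠ [] := fun e => h0 (by simpa using congrArg bitsToNat e)
    rw [ym1F, iteFn_apply_false (by simp [hy, isNilFn, hne])]
    simp [hy, h0]

/-- Shor's divisor. [folklore] -/
theorem d3F_recOf_of_le (hm : 2 ≤ m) (h : m.size ≤ as.length) :
    d3F ρ = encodeNat (Nat.gcd (let y := (blockVal x c % 2 ^ m.size) ^ (ofAnswerBits (as.take m.size) / 2) % m; if y = 0 then m - 1 else y - 1) m) := by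
  simp [d3F, ym1F_recOf_of_le x c as m k rest done st hm h]

/-- `m / d`. [folklore] -/
theorem quoF_recOf {d : List Bool → List Bool} {d' : ℕ} (hd : d ρ = encodeNat d') : quoF d ρ = encodeNat (m / d') := by
  simp [quoF, hd]

/-! ### The conditions on a configuration -/

/-- Value equality. [folklore] -/
theorem eqValF_apply (f g : List Bool → List Bool) (z : List Bool) : eqValF f g z = [decide (bitsToNat (f z) = bitsToNat (g z))] := by
  have h1 : (ltFn ∘ pr f g) z = [decide (bitsToNat (f z) < bitsToNat (g z))] := by simp
  have h2 : (ltFn ∘ pr g f) z = [decide (bitsToNat (g z) < bitsToNat (f z))] := by simp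
  rw [eqValF, andFn_apply (notFn_apply h1) (notFn_apply h2)]
  congr 1
  by_cases h : bitsToNat (f z) = bitsToNat (g z)
  · simp [h]
  · rcases Nat.lt_or_gt_of_ne h with hlt | hgt
    · simp [h, hlt]
    · simp [h, hgt, not_lt.2 hgt.le]

/-- `eqValF` is one-bit. [folklore] -/
theorem oneBit_eqValF (f g : List Bool → List Bool) : OneBit (eqValF f g) := fun z => ⟨_, eqValF_apply f g z⟩

/-- The parity test of the top number. [folklore] -/
@[simp] theorem cEven_recOf : cEven ρ = [decide (Even m)] := by simp [cEven, parityFn]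
/-- The test `m = 2`. [folklore] -/
@[simp] theorem cTwo_recOf : cTwo ρ = [decide (m = 2)] := by
  rw [cTwo, eqValF_apply]; simp [twoF]
/-- `cPP_recOf`. [folklore] -/
theorem cPP_recOf (hm : 2 ≤ m) : cPP ρ = [decide (ppBase m < m)] := by
  simp [cPP, ppDF_recOf x c as m k rest done st hm]
/-- The test for a useless draw (`0` or `≥ m`). [folklore] -/
@[simp] theorem cBad_recOf : cBad ρ = [decide (blockVal x c % 2 ^ m.size = 0 ∨ m ≤ blockVal x c % 2 ^ m.size)] := by
  set v := blockVal x c % 2 ^ m.size with hv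
  by_cases h0 : v = 0
  · rw [cBad, iteFn_apply_true (by simp [← hv, h0, isNilFn]; rfl)]
    simp [h0]
  · have hne : encodeNat v ≠ [] := fun e => h0 (by simpa using congrArg bitsToNat e)
    have h1 : (ltFn ∘ pr xlF mF) (recOf x c as ((m, k) :: rest) done st) = [decide (v < m)] := by simp [← hv]
    rw [cBad, iteFn_apply_false (by simp [← hv, isNilFn, hne]), notFn_apply h1]
    by_cases hle : m ≤ v
    · simp [h0, hle, not_lt.2 hle]
    · simp [h0, hle, not_le.1 hle]
/-- The test for a lucky draw (nontrivial gcd). [folklore] -/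
@[simp] theorem cG_recOf : cG ρ = [decide (1 < Nat.gcd (blockVal x c % 2 ^ m.size) m)] := by
  simp [cG, valGeTwoFn]; omega
/-- `cOk_recOf_of_le`. [folklore] -/
theorem cOk_recOf_of_le (h : m.size ≤ as.length) : cOk ρ = [true] := by
  simp [cOk, obF_recOf_of_le x c as m k rest done st h]
/-- `cOk_recOf_of_lt`. [folklore] -/
theorem cOk_recOf_of_lt (h : as.length < m.size) : cOk ρ = [false] := by
  simp [cOk, obF_recOf_of_lt x c as m k rest done st h]

/-- Divisibility of `t + 1` read off the residue of `t`. [folklore] -/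
theorem dvd_add_one_iff {m t : ℕ} (hm : 2 ≤ m) : m ∣ t + 1 ↔ t % m + 1 = m := by
  rw [Nat.dvd_iff_mod_eq_zero]
  have hlt := Nat.mod_lt t (show 0 < m by omega)
  constructor
  · intro h
    have := Nat.add_mod t 1 m
    rw [h, Nat.mod_eq_of_lt (show 1 < m by omega)] at this
    -- `(t % m + 1) % m = 0` with `t % m + 1 ≤ m`
    by_contra hne
    have hlt2 : t % m + 1 < m := by omega
    rw [Nat.mod_eq_of_lt hlt2] at this
    omega
  · intro h
    rw [Nat.add_mod, Nat.mod_eq_of_lt (show 1 < m by omega), h, Nat.mod_self]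

/-- Shor's criterion. [folklore] -/
theorem cShor_recOf_of_le (hm : 2 ≤ m) (h : m.size ≤ as.length) :
    cShor ρ = [decide (Even (ofAnswerBits (as.take m.size)) ∧ ¬ m ∣ (blockVal x c % 2 ^ m.size) ^ (ofAnswerBits (as.take m.size) / 2) + 1)] := by
  have hr := rOrIdxF_recOf_of_le x c as m k rest done st h
  have hy := yF_recOf_of_le x c as m k rest done st hm h
  set r := ofAnswerBits (as.take m.size) with hrdef
  set y := (blockVal x c % 2 ^ m.size) ^ (r / 2) % m with hydef
  have h1 : (parityFn ∘ rOrIdxF) (recOf x c as ((m, k) :: rest) done st) = [decide (Even r)] := by simp [hr, parityFn]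
  have h2 : eqValF (succF ∘ yF) mF (recOf x c as ((m, k) :: rest) done st) = [decide (y + 1 = m)] := by
    rw [eqValF_apply]; simp [hy]
  rw [cShor, andFn_apply h1 (notFn_apply h2)]
  have hiff : m ∣ (blockVal x c % 2 ^ m.size) ^ (r / 2) + 1 ↔ y + 1 = m := by rw [dvd_add_one_iff hm, ← hydef]
  by_cases he : Even r <;> by_cases hy1 : y + 1 = m <;> simp [he, hy1, hiff]

/-- The test for the last attempt of the budget. [folklore] -/
@[simp] theorem cLast_recOf : cLast ρ = [decide (k ≤ 1)] := by
  have h1 : (valGeTwoFn ∘ kF) (recOf x c as ((m, k) :: rest) done st) = [decide (2 ≤ k)] := by simp [valGeTwoFn]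
  rw [cLast, notFn_apply h1]
  by_cases hk : k ≤ 1
  · simp [hk, show ¬ 2 ≤ k by omega]
  · simp [hk, show 2 ≤ k by omega]
/-- The running test (empty status). [folklore] -/
@[simp] theorem cRun_recOf (todo : List (ℕ × ℕ)) : cRun (recOf x c as todo done st) = [decide (st = [])] := by simp [cRun, isNilFn]
/-- The idle test (empty work list). [folklore] -/
@[simp] theorem cIdle_recOf (todo : List (ℕ × ℕ)) : cIdle (recOf x c as todo done st) = [decide (todo = [])] := by
  simp [cIdle, isNilFn]
  cases todo <;> simp [encList_cons, boolPair]
/-- `cCap_recOf`. [folklore] -/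
theorem cCap_recOf : cCap ρ = [decide (m.size ≤ x.length + 1)] := by
  simp [cCap, lenLeFn_boolPair, TM2Pass.length_encodeNat_eq_size]

end Eval

/-! ### The outcomes on a configuration -/

section Outcomes

variable (x : List Bool) (c : List Bool) (as : List (List Bool)) (m k : ℕ) (rest : List (ℕ × ℕ)) (done : List ℕ) (st : List Bool)

local notation "ρ" => recOf x c as ((m, k) :: rest) done st

/-- The split outcome. [folklore] -/
theorem splitR_recOf {d A : List Bool → List Bool} {d' : ℕ} {A' : List (List Bool)} (hd : d ρ = encodeNat d') (hA : A ρ = encList A') :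
    splitR d A ρ = recOf x (c.drop (x.length + 1)) A' ((d', budget x.length) :: (m / d', budget x.length) :: rest) done [] := by
  have hq : quoF d ρ = encodeNat (m / d') := quoF_recOf x c as m k rest done st hd
  have hb : budgetF ρ = encodeNat (budget x.length) := by rw [budgetF_eq, xF_recOf]
  simp only [splitR, mk7_apply, fanoutFn_apply, xF_recOf, co'F_recOf, restF_recOf, restBF_recOf, dnF_recOf, hd, hA, hq, hb]
  simp [recOf, encList_cons]

/-- The failure outcome, last attempt. [folklore] -/
theorem failR_recOf_of_le {A : List Bool → List Bool} {A' : List (List Bool)} (hA : A ρ = encList A') (hk : k ≤ 1) :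
    failR A ρ = recOf x (c.drop (x.length + 1)) A' rest (m :: done) [] := by
  rw [failR, iteFn_apply_true (by rw [cLast_recOf]; simp [hk])]
  simp only [mk7_apply, fanoutFn_apply, xF_recOf, co'F_recOf, restF_recOf, restBF_recOf, mF_recOf, dnF_recOf, hA]
  simp [recOf, encList_cons]

/-- The failure outcome, attempts left. [folklore] -/
theorem failR_recOf_of_lt {A : List Bool → List Bool} {A' : List (List Bool)} (hA : A ρ = encList A') (hk : 1 < k) :
    failR A ρ = recOf x (c.drop (x.length + 1)) A' ((m, k - 1) :: rest) done [] := by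
  rw [failR, iteFn_apply_false (by rw [cLast_recOf]; simp; omega)]
  simp only [mk7_apply, fanoutFn_apply, Function.comp_apply, xF_recOf, co'F_recOf, restF_recOf, restBF_recOf, mF_recOf,
    kF_recOf, dnF_recOf, hA, predF_apply, bitsToNat_encodeNat]
  simp [recOf, encList_cons]

/-- The pending order query in the tree's encoding. [folklore] -/
theorem orderQuery_eq (xl i : ℕ) :
    orderQueryEncoding.encode ((xl, m), i) = boolPair (boolPair (encodeNat xl) (encodeNat m)) (encodeNat i) := rfl

/-- The stuck outcome under the cap, with too few answers recorded. [folklore] -/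
theorem stuckR_recOf (hcap : m.size ≤ x.length + 1) (h : as.length < m.size) :
    stuckR ρ = recOf x (c.drop (x.length + 1)) as ((m, k) :: rest) done
      (true :: orderQueryEncoding.encode ((blockVal x c % 2 ^ m.size, m), as.length)) := by
  have hq : (iteFn cCap (List.cons true ∘ pr (pr xlF mF) rOrIdxF) (fun _ => [true])) ρ =
      true :: boolPair (boolPair (encodeNat (blockVal x c % 2 ^ m.size)) (encodeNat m)) (encodeNat as.length) := by
    rw [iteFn_apply_true (by rw [cCap_recOf]; simp [hcap])]
    simp [rOrIdxF_recOf_of_lt x c as m k rest done st h]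
  simp only [stuckR, mk7_apply, hq, orderQuery_eq, xF_recOf, co'F_recOf, asF_recOf, tnF_recOf, tbF_recOf, dnF_recOf]
  simp [recOf, encList_cons]

/-- The idle outcome. [folklore] -/
theorem idleR_recOf (todo : List (ℕ × ℕ)) : idleR (recOf x c as todo done st) = recOf x (c.drop (x.length + 1)) as todo done st := by
  simp only [idleR, mk7_apply, xF_recOf, co'F_recOf, asF_recOf, tnF_recOf, tbF_recOf, dnF_recOf, stF_recOf]
  rfl

/-- The stuck-record outcome. [folklore] -/
theorem sameR_recOf (todo : List (ℕ × ℕ)) : sameR (recOf x c as todo done st) = recOf x c as todo done st := by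
  simp only [sameR, mk7_apply, xF_recOf, coF_recOf, asF_recOf, tnF_recOf, tbF_recOf, dnF_recOf, stF_recOf]
  rfl

end Outcomes

/-- Shor's `gcd (t - 1, m)` from the residue `y = t mod m`: the representative of `t - 1` is
`m - 1` if `y = 0`, else `y - 1` (`t ≥ 1`, `m ≥ 2`). [folklore] -/
theorem gcd_pow_sub_one_eq {m t : ℕ} (hm : 2 ≤ m) (ht : 1 ≤ t) :
    Nat.gcd (let y := t % m; if y = 0 then m - 1 else y - 1) m = Nat.gcd (t - 1) m := by
  have hm0 : 0 < m := by omega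
  have hsplit : m * (t / m) + t % m = t := Nat.div_add_mod t m
  have hylt : t % m < m := Nat.mod_lt t hm0
  have hmod : (t - 1) % m = (if t % m = 0 then m - 1 else t % m - 1) := by
    split_ifs with h0
    · have hq1 : 1 ≤ t / m := by
        by_contra hq0
        have hz : t / m = 0 := Nat.lt_one_iff.mp (Nat.lt_of_not_le hq0)
        rw [hz, h0] at hsplit; omega
      have hstep : m * (t / m) = m * (t / m - 1) + m := by
        rw [← Nat.mul_succ]; congr 1; omega
      have e : t - 1 = m * (t / m - 1) + (m - 1) := by omega
      rw [e, Nat.mul_add_mod, Nat.mod_eq_of_lt (by omega)]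
    · have e : t - 1 = m * (t / m) + (t % m - 1) := by omega
      rw [e, Nat.mul_add_mod, Nat.mod_eq_of_lt (by omega)]
  dsimp only
  rw [Nat.gcd_comm (t - 1) m, Nat.gcd_rec m (t - 1), hmod]

/-! ### The round on a configuration -/

section Round

variable (x : List Bool) (c : List Bool) (as : List (List Bool)) (done : List ℕ)

/-- **A stuck record is kept.** [folklore] -/
theorem roundF_recOf_stuck (todo : List (ℕ × ℕ)) {st : List Bool} (hst : st ≠ []) :
    roundF (recOf x c as todo done st) = recOf x c as todo done st := by
  rw [roundF, iteFn_apply_false (by rw [cRun_recOf]; simp [hst]), sameR_recOf]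

/-- **An idle round** (empty work list): the coins move. [folklore] -/
theorem roundF_recOf_idle : roundF (recOf x c as [] done []) = recOf x (c.drop (x.length + 1)) as [] done [] := by
  rw [roundF, iteFn_apply_true (by rw [cRun_recOf]; simp), iteFn_apply_true (by rw [cIdle_recOf]; simp), idleR_recOf]

variable (m k : ℕ) (rest : List (ℕ × ℕ))

local notation "ρ₀" => recOf x c as ((m, k) :: rest) done []

/-- The record after a splitting attempt, according to the replay outcome. [folklore] -/
def afterR : List Bool ⊕ (Option ℕ × List (List Bool)) → List Bool
  | Sum.inl q => recOf x (c.drop (x.length + 1)) as ((m, k) :: rest) done (true :: q)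
  | Sum.inr (some d, as') => recOf x (c.drop (x.length + 1)) as' ((d, budget x.length) :: (m / d, budget x.length) :: rest) done []
  | Sum.inr (none, as') =>
    if k ≤ 1 then recOf x (c.drop (x.length + 1)) as' rest (m :: done) []
    else recOf x (c.drop (x.length + 1)) as' ((m, k - 1) :: rest) done []

/-- `failR` realises the failure outcome. [folklore] -/
theorem failR_eq_afterR {A : List Bool → List Bool} {A' : List (List Bool)} (hA : A ρ₀ = encList A') :
    failR A ρ₀ = afterR x c as done m k rest (Sum.inr (none, A')) := by
  rw [afterR]
  by_cases hk : k ≤ 1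
  · rw [if_pos hk]; exact failR_recOf_of_le x c as m k rest done [] hA hk
  · rw [if_neg hk]; exact failR_recOf_of_lt x c as m k rest done [] hA (by omega)

/-- `splitR` realises the split outcome. [folklore] -/
theorem splitR_eq_afterR {d A : List Bool → List Bool} {d' : ℕ} {A' : List (List Bool)} (hd : d ρ₀ = encodeNat d') (hA : A ρ₀ = encList A') :
    splitR d A ρ₀ = afterR x c as done m k rest (Sum.inr (some d', A')) := by
  rw [afterR]; exact splitR_recOf x c as m k rest done [] hd hA

/-- **The round realises one splitting attempt** (`Shor1997.splitStepR`) on the record of a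
running configuration whose top number satisfies `2 ≤ m` and the cap `size m ≤ |x| + 1`, with the
block value read off the next `|x| + 1` coins. [cite: Shor1997SICOMP, §5 p.16 (reduction of factoring to order finding)] -/
theorem roundF_recOf (hm : 2 ≤ m) (hcap : m.size ≤ x.length + 1) :
    roundF ρ₀ = afterR x c as done m k rest (splitStepR m (blockVal x c) as) := by
  have hrun : cRun ρ₀ = [true] := by rw [cRun_recOf]; simp
  have hidle : cIdle ρ₀ = [false] := by rw [cIdle_recOf]; simp
  rw [roundF, iteFn_apply_true hrun, iteFn_apply_false hidle]
  set X := blockVal x c with hX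
  set xl := X % 2 ^ m.size with hxl
  by_cases he : Even m
  · -- even
    rw [iteFn_apply_true (by rw [cEven_recOf]; simp [he])]
    have hs : splitStepR m X as = Sum.inr ((if m = 2 then none else some 2), as) := by simp [splitStepR, he]
    rw [hs]
    by_cases h2 : m = 2
    · rw [iteFn_apply_true (by rw [cTwo_recOf]; simp [h2]), if_pos h2]
      exact failR_eq_afterR x c as done m k rest (by simp)
    · rw [iteFn_apply_false (by rw [cTwo_recOf]; simp [h2]), if_neg h2]
      exact splitR_eq_afterR x c as done m k rest (by simp [twoF]; rfl) (by simp)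
  rw [iteFn_apply_false (by rw [cEven_recOf]; simp [he])]
  by_cases hpp : ppBase m < m
  · -- perfect power
    rw [iteFn_apply_true (by rw [cPP_recOf x c as m k rest done [] hm]; simp [hpp])]
    have hs : splitStepR m X as = Sum.inr (some (ppBase m), as) := by simp [splitStepR, he, hpp]
    rw [hs]
    exact splitR_eq_afterR x c as done m k rest (by simp [ppDF_recOf x c as m k rest done [] hm, hpp]) (by simp)
  rw [iteFn_apply_false (by rw [cPP_recOf x c as m k rest done [] hm]; simp [hpp])]
  by_cases hbad : xl = 0 ∨ m ≤ xl
  · -- failed draw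
    rw [iteFn_apply_true (by rw [cBad_recOf]; simp only [← hX, ← hxl]; simp [hbad])]
    have hs : splitStepR m X as = Sum.inr (none, as) := by
      simp only [splitStepR, if_neg he, if_neg hpp, ← hxl]
      rw [if_pos hbad]
    rw [hs]
    exact failR_eq_afterR x c as done m k rest (by simp)
  rw [iteFn_apply_false (by rw [cBad_recOf]; simp only [← hX, ← hxl]; simp [hbad])]
  by_cases hg : 1 < Nat.gcd xl m
  · -- non-unit: the gcd
    rw [iteFn_apply_true (by rw [cG_recOf]; simp only [← hX, ← hxl]; simp [hg])]
    have hs : splitStepR m X as = Sum.inr (some (Nat.gcd xl m), as) := by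
      simp only [splitStepR, if_neg he, if_neg hpp, ← hxl]
      rw [if_neg hbad, if_pos hg]
    rw [hs]
    exact splitR_eq_afterR x c as done m k rest (by rw [gF_recOf]) (by simp)
  rw [iteFn_apply_false (by rw [cG_recOf]; simp only [← hX, ← hxl]; simp [hg])]
  by_cases hok : m.size ≤ as.length
  · -- the order block is available
    rw [iteFn_apply_true (cOk_recOf_of_le x c as m k rest done [] hok)]
    set r := ofAnswerBits (as.take m.size) with hr
    have hs : splitStepR m X as = Sum.inr ((if Even r ∧ ¬ m ∣ xl ^ (r / 2) + 1 then some (Nat.gcd (xl ^ (r / 2) - 1) m) else none), as.drop m.size) := by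
      simp only [splitStepR, if_neg he, if_neg hpp, ← hxl]
      rw [if_neg hbad, if_neg hg]
      simp [orderR, hok, ← hr]
    rw [hs]
    have hA : as'F ρ₀ = encList (as.drop m.size) := as'F_recOf_of_le x c as m k rest done [] hok
    have hcsh : cShor ρ₀ = [decide (Even r ∧ ¬ m ∣ xl ^ (r / 2) + 1)] := by
      rw [cShor_recOf_of_le x c as m k rest done [] hm hok]
    by_cases hsh : Even r ∧ ¬ m ∣ xl ^ (r / 2) + 1
    · rw [iteFn_apply_true (by rw [hcsh]; simp [hsh]), if_pos hsh]
      refine splitR_eq_afterR x c as done m k rest ?_ hA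
      have hxl0 : xl ≠ 0 := fun h0 => hbad (Or.inl h0)
      have key := gcd_pow_sub_one_eq (m := m) (t := xl ^ (r / 2)) (by omega) (Nat.one_le_pow _ _ (Nat.pos_of_ne_zero hxl0))
      rw [d3F_recOf_of_le x c as m k rest done [] hm hok, ← key]
    · rw [iteFn_apply_false (by rw [hcsh]; simp [hsh]), if_neg hsh]
      exact failR_eq_afterR x c as done m k rest hA
  · -- stuck: the pending query
    push Not at hok
    rw [iteFn_apply_false (cOk_recOf_of_lt x c as m k rest done [] hok)]
    have hs : splitStepR m X as = Sum.inl (orderQueryEncoding.encode ((xl, m), as.length)) := by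
      simp only [splitStepR, if_neg he, if_neg hpp, ← hxl]
      rw [if_neg hbad, if_neg hg]
      simp [orderR, show ¬ m.size ≤ as.length by omega]
    rw [hs]
    exact stuckR_recOf x c as m k rest done [] hcap hok

/-- The number `1` is never a nontrivial perfect power for `ppF`, and `ppBase 1 = 1`. [folklore] -/
theorem cPP_recOf_one : cPP (recOf x c as ((1, k) :: rest) done []) = [false] := by
  have h1 : ppF (encodeNat 1) = boolPair [false] [] := by
    rw [show encodeNat 1 = [true] from rfl, ppF_apply [true] (by simp) (by simp)]
    have hne : ¬ ∃ k', k' ≤ 1 ∧ IsPP 1 k' := by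
      rintro ⟨k', hk', h2, -⟩; omega
    simp only [List.length_singleton, bitsToNat_cons, bitsToNat_nil, Bool.toNat_true, Nat.mul_zero, Nat.add_zero] at *
    rw [if_neg hne]; simp [hne]
  simp [cPP, ppDF, h1]

/-- `ppBase 1 = 1`. [folklore] -/
theorem ppBase_one : ppBase 1 = 1 := by
  obtain ⟨k', hk', h⟩ := ppBase_spec 1
  rw [pow_eq_one_iff] at h
  exact h.resolve_right hk'.ne'

/-- **The round on a top number `1`**: a failed attempt (as in `splitStepR 1`, where the draw
`X mod 2` is always `0` or `≥ 1`). [folklore] -/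
theorem roundF_recOf_one : roundF (recOf x c as ((1, k) :: rest) done []) = afterR x c as done 1 k rest (splitStepR 1 (blockVal x c) as) := by
  have hrun : cRun (recOf x c as ((1, k) :: rest) done []) = [true] := by rw [cRun_recOf]; simp
  have hidle : cIdle (recOf x c as ((1, k) :: rest) done []) = [false] := by rw [cIdle_recOf]; simp
  have hbadP : blockVal x c % 2 ^ Nat.size 1 = 0 ∨ 1 ≤ blockVal x c % 2 ^ Nat.size 1 := by omega
  have hs : splitStepR 1 (blockVal x c) as = Sum.inr (none, as) := by
    simp only [splitStepR, if_neg (show ¬ Even 1 by decide), ppBase_one, lt_irrefl, if_false]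
    rw [if_pos hbadP]
  rw [roundF, iteFn_apply_true hrun, iteFn_apply_false hidle, iteFn_apply_false (by rw [cEven_recOf]; decide),
    iteFn_apply_false (cPP_recOf_one x c as done k rest), iteFn_apply_true (by rw [cBad_recOf]; simp; omega), hs]
  exact failR_eq_afterR x c as done 1 k rest (by simp)

/-- **The round realises `Shor1997.wstepR`** on a running configuration (top number `≥ 2` and
within the cap). [cite: Shor1997SICOMP, §5 p.16 (the reduction, repeated and recursed)] -/
theorem roundF_recOf_wstepR (hm : 1 ≤ m) (hcap : m.size ≤ x.length + 1) :
    roundF ρ₀ =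
      match wstepR (budget x.length) ⟨done, (m, k) :: rest⟩ (blockVal x c) as with
      | Sum.inl q => recOf x (c.drop (x.length + 1)) as ((m, k) :: rest) done (true :: q)
      | Sum.inr (s', as') => recOf x (c.drop (x.length + 1)) as' s'.todo s'.done [] := by
  have hround : roundF ρ₀ = afterR x c as done m k rest (splitStepR m (blockVal x c) as) := by
    rcases Nat.lt_or_ge 1 m with h2 | h1
    · exact roundF_recOf x c as done m k rest h2 hcap
    · obtain rfl : m = 1 := le_antisymm h1 hm
      exact roundF_recOf_one x c as done k rest
  rw [hround]
  simp only [wstepR]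
  rcases splitStepR m (blockVal x c) as with q | ⟨o, as'⟩
  · rfl
  · cases o with
    | some d => rfl
    | none =>
      rw [afterR]
      by_cases hk : k ≤ 1
      · simp [hk]
      · simp [hk]

end Round

/-- Sizes are superadditive up to one: `size a + size b ≤ size (a b) + 1` for `a, b ≥ 1`.
[folklore] -/
theorem size_add_size_le_size_mul {a b : ℕ} (ha : 1 ≤ a) (hb : 1 ≤ b) : a.size + b.size ≤ (a * b).size + 1 := by
  have ha' : 2 ^ (a.size - 1) ≤ a := by
    have := Nat.lt_size_self a
    rcases Nat.eq_zero_or_pos a.size with h | h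
    · simp [h]; exact ha
    · exact Nat.lt_size.1 (by omega)
  have hb' : 2 ^ (b.size - 1) ≤ b := by
    rcases Nat.eq_zero_or_pos b.size with h | h
    · simp [h]; exact hb
    · exact Nat.lt_size.1 (by omega)
  have hab : 2 ^ (a.size - 1 + (b.size - 1)) ≤ a * b := by rw [pow_add]; exact Nat.mul_le_mul ha' hb'
  have : a.size - 1 + (b.size - 1) < (a * b).size := Nat.lt_size.2 hab
  have hsa : 1 ≤ a.size := Nat.size_pos.2 ha
  have hsb : 1 ≤ b.size := Nat.size_pos.2 hb
  omega

/-- For a divisor `d ≥ 1` of `v ≥ 1`: `size d + size (v / d) ≤ size v + 1`. [folklore] -/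
theorem size_add_size_div_le {d v : ℕ} (hd : d ∣ v) (hv : 0 < v) : d.size + (v / d).size ≤ v.size + 1 := by
  have hd1 : 1 ≤ d := Nat.pos_of_dvd_of_pos hd hv
  have hq1 : 1 ≤ v / d := Nat.div_pos (Nat.le_of_dvd hv hd) hd1
  have := size_add_size_le_size_mul hd1 hq1
  rwa [Nat.mul_div_cancel' hd] at this

/-! ### The first field is kept; the growth of one round -/

section Growth

/-- `f` keeps the first field of its argument. [folklore] -/
def KeepsFst (f : List Bool → List Bool) : Prop := ∀ z, fstF (f z) = fstF z

/-- Branching keeps the first field if both branches do. [folklore] -/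
theorem KeepsFst.ite {c f g : List Bool → List Bool} (hc : OneBit c) (hf : KeepsFst f) (hg : KeepsFst g) : KeepsFst (iteFn c f g) := by
  intro z
  obtain ⟨b, hb⟩ := hc z
  cases b
  · rw [iteFn_apply_false hb]; exact hg z
  · rw [iteFn_apply_true hb]; exact hf z

/-- A record assembled with `xF` first keeps the first field. [folklore] -/
theorem keepsFst_mk7 (b c d e f g : List Bool → List Bool) : KeepsFst (mk7 xF b c d e f g) := fun z => by
  rw [mk7_apply]; simp [rec7]; rfl

/-! #### The conditions are one-bit -/

/-- `oneBit_cRun`. [folklore] -/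
theorem oneBit_cRun : OneBit cRun := oneBit_isNilFn.comp _
/-- `oneBit_cIdle`. [folklore] -/
theorem oneBit_cIdle : OneBit cIdle := oneBit_isNilFn.comp _
/-- `oneBit_cEven`. [folklore] -/
theorem oneBit_cEven : OneBit cEven := oneBit_parityFn.comp _
/-- `oneBit_cTwo`. [folklore] -/
theorem oneBit_cTwo : OneBit cTwo := oneBit_eqValF _ _
/-- `oneBit_cPP`. [folklore] -/
theorem oneBit_cPP : OneBit cPP := fun z => oneBit_fstF_ppF (mF z)
/-- `oneBit_cBad`. [folklore] -/
theorem oneBit_cBad : OneBit cBad := (oneBit_isNilFn.comp _).ite (oneBit_const true) (oneBit_notFn (oneBit_ltFn.comp _))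
/-- `oneBit_cG`. [folklore] -/
theorem oneBit_cG : OneBit cG := oneBit_valGeTwoFn.comp _
/-- `oneBit_cOk`. [folklore] -/
theorem oneBit_cOk : OneBit cOk := fun z =>
  ⟨!(obRun (mF z).length (asF z)).2.2.2, by simp [cOk, obF, takeItemsFn, takeItemsVal]⟩
/-- `oneBit_cShor`. [folklore] -/
theorem oneBit_cShor : OneBit cShor := oneBit_andFn (oneBit_parityFn.comp _) (oneBit_notFn (oneBit_eqValF _ _))
/-- `oneBit_cLast`. [folklore] -/
theorem oneBit_cLast : OneBit cLast := oneBit_notFn (oneBit_valGeTwoFn.comp _)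
/-- `oneBit_cCap`. [folklore] -/
theorem oneBit_cCap : OneBit cCap := (oneBit_lenLeFn _).comp _

/-- **`roundF` keeps the first field** (the input numeral `x`), on every string. [folklore] -/
theorem fstF_roundF (z : List Bool) : fstF (roundF z) = fstF z := by
  have hsplit : ∀ d A, KeepsFst (splitR d A) := fun d A => keepsFst_mk7 _ _ _ _ _ _
  have hfail : ∀ A, KeepsFst (failR A) := fun A => KeepsFst.ite oneBit_cLast (keepsFst_mk7 _ _ _ _ _ _) (keepsFst_mk7 _ _ _ _ _ _)
  have h : KeepsFst roundF :=
    KeepsFst.ite oneBit_cRun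
      (KeepsFst.ite oneBit_cIdle (keepsFst_mk7 _ _ _ _ _ _)
        (KeepsFst.ite oneBit_cEven (KeepsFst.ite oneBit_cTwo (hfail _) (hsplit _ _))
          (KeepsFst.ite oneBit_cPP (hsplit _ _)
            (KeepsFst.ite oneBit_cBad (hfail _)
              (KeepsFst.ite oneBit_cG (hsplit _ _)
                (KeepsFst.ite oneBit_cOk (KeepsFst.ite oneBit_cShor (hsplit _ _) (hfail _)) (keepsFst_mk7 _ _ _ _ _ _)))))))
      (keepsFst_mk7 _ _ _ _ _ _)
  exact h z

/-! #### Lengths of records and fields -/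

/-- Length of a record. [folklore] -/
theorem length_rec7 (a b c d e f g : List Bool) :
    (rec7 a b c d e f g).length = 2 * a.length + 2 * b.length + 2 * c.length + 2 * d.length + 2 * e.length + 2 * f.length + g.length + 12 := by
  simp [rec7, length_boolPair]; ring

/-- The seven fields of any string fit in it, with the first six doubled. [folklore] -/
theorem length_fields_le (z : List Bool) :
    2 * (xF z).length + 2 * (coF z).length + 2 * (asF z).length + 2 * (tnF z).length + 2 * (tbF z).length +
      2 * (dnF z).length + (stF z).length ≤ z.length := by
  have h0 := length_fstF_sndF_le z
  have h1 : 2 * (nthF 1 z).length + (sndPow 1 z).length ≤ (sndPow 0 z).length := length_nthF_succ_add_sndPow_succ_le 0 z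
  have h2 : 2 * (nthF 2 z).length + (sndPow 2 z).length ≤ (sndPow 1 z).length := length_nthF_succ_add_sndPow_succ_le 1 z
  have h3 : 2 * (nthF 3 z).length + (sndPow 3 z).length ≤ (sndPow 2 z).length := length_nthF_succ_add_sndPow_succ_le 2 z
  have h4 : 2 * (nthF 4 z).length + (sndPow 4 z).length ≤ (sndPow 3 z).length := length_nthF_succ_add_sndPow_succ_le 3 z
  have h5 : 2 * (nthF 5 z).length + (sndPow 5 z).length ≤ (sndPow 4 z).length := length_nthF_succ_add_sndPow_succ_le 4 z
  have e0 : nthF 0 z = fstF z := rfl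
  have e1 : sndPow 0 z = sndF z := rfl
  simp only [xF, coF, asF, tnF, tbF, dnF, stF, e0] at *
  rw [e1] at h1
  omega

/-- The top of the work list and the rest fit in the work-list field. [folklore] -/
theorem length_mF_restF_le (z : List Bool) : 2 * (mF z).length + (restF z).length ≤ (tnF z).length := length_fstF_sndF_le _
/-- The top budget and the rest fit in the budget field. [folklore] -/
theorem length_kF_restBF_le (z : List Bool) : 2 * (kF z).length + (restBF z).length ≤ (tbF z).length := length_fstF_sndF_le _

/-- The remaining coins are a suffix of the coins. [folklore] -/
theorem co'F_eq (z : List Bool) : co'F z = (coF z).drop ((xF z).length + 1) := by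
  simp [co'F, blkF]
/-- `length_co'F_le`. [folklore] -/
theorem length_co'F_le (z : List Bool) : (co'F z).length ≤ (coF z).length := by rw [co'F_eq]; simp

/-- The block has width `|x| + 1`. [folklore] -/
theorem length_blockF (z : List Bool) : (blockF z).length = (xF z).length + 1 := by
  simp [blockF, blkF]

/-- `|xlF z| ≤ |mF z|`. [folklore] -/
theorem length_xlF_le (z : List Bool) : (xlF z).length ≤ (mF z).length := by
  simp only [xlF, Function.comp_apply, fanoutFn_apply, lowBitsFn_boolPair]
  refine (length_norm_le _).trans ?_
  simp

/-- A canonical numeral of a value at most `⟦w⟧` is not longer than `w`. [folklore] -/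
theorem length_encodeNat_le_of_le_bitsToNat {v : ℕ} {w : List Bool} (h : v ≤ bitsToNat w) : (encodeNat v).length ≤ w.length :=
  (length_encodeNat_mono h).trans (length_encodeNat_bitsToNat_le w)

/-- `|gF z| ≤ |mF z|`. [folklore] -/
theorem length_gF_le (z : List Bool) : (gF z).length ≤ (mF z).length := by
  simp only [gF, Function.comp_apply, fanoutFn_apply, gcdFn_boolPair]
  rcases Nat.eq_zero_or_pos (bitsToNat (mF z)) with h0 | hpos
  · rw [h0, Nat.gcd_zero_right]
    exact (length_encodeNat_bitsToNat_le _).trans (length_xlF_le z)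
  · exact length_encodeNat_le_of_le_bitsToNat (Nat.gcd_le_right _ hpos)

/-- `|quoF d z| ≤ |mF z|`. [folklore] -/
theorem length_quoF_le (d : List Bool → List Bool) (z : List Bool) : (quoF d z).length ≤ (mF z).length := by
  simp only [quoF, Function.comp_apply, fanoutFn_apply, divFn_boolPair]
  exact length_encodeNat_le_of_le_bitsToNat (Nat.div_le_self _ _)

/-- The value of `yF z` is below `⟦mF z⟧`, or `yF z` is empty. [folklore] -/
theorem yF_eq (z : List Bool) : yF z = (if bitsToNat (mF z) ≤ 1 then []
    else encodeNat (bitsToNat (xlF z) ^ bitsToNat (halfF z) % bitsToNat (mF z))) := by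
  simp only [yF, Function.comp_apply, fanoutFn_apply, modExpFn, modExpVal, boolUnpair_boolPair]

/-- `|yF z| ≤ |mF z|`. [folklore] -/
theorem length_yF_le (z : List Bool) : (yF z).length ≤ (mF z).length := by
  rw [yF_eq]
  split_ifs with h
  · simp
  · exact length_encodeNat_le_of_le_bitsToNat (Nat.mod_lt _ (by omega)).le

/-- The value of `ym1F z`. [folklore] -/
theorem ym1F_eq (z : List Bool) : ym1F z = (if yF z = [] then encodeNat (bitsToNat (mF z) - 1) else encodeNat (bitsToNat (yF z) - 1)) := by
  by_cases h : yF z = []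
  · rw [ym1F, iteFn_apply_true (by simp [isNilFn, h]), if_pos h]; simp
  · rw [ym1F, iteFn_apply_false (by simp [isNilFn, h]), if_neg h]; simp

/-- `⟦ym1F z⟧ < ⟦mF z⟧` unless `⟦mF z⟧ = 0` (then `ym1F z = []`). [folklore] -/
theorem bitsToNat_ym1F_le (z : List Bool) : bitsToNat (ym1F z) ≤ bitsToNat (mF z) - 1 := by
  rw [ym1F_eq]
  split_ifs with h
  · simp
  · have hy := yF_eq z
    rw [hy] at h ⊢
    split_ifs at h ⊢ with h1
    · simp at h
    · simp only [bitsToNat_encodeNat]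
      have := Nat.mod_lt (bitsToNat (xlF z) ^ bitsToNat (halfF z)) (show 0 < bitsToNat (mF z) by omega)
      omega

/-- `|d3F z| + |quoF d3F z| ≤ |mF z| + 1`: the divisor is a divisor. [folklore] -/
theorem length_d3F_add_le (z : List Bool) : (d3F z).length + (quoF d3F z).length ≤ (mF z).length + 1 := by
  have hym := bitsToNat_ym1F_le z
  have hd3 : d3F z = encodeNat (Nat.gcd (bitsToNat (ym1F z)) (bitsToNat (mF z))) := by
    simp [d3F]
  have hq : quoF d3F z = encodeNat (bitsToNat (mF z) / Nat.gcd (bitsToNat (ym1F z)) (bitsToNat (mF z))) := by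
    simp [quoF, hd3]
  rw [hd3, hq]
  set v := bitsToNat (mF z) with hv
  set g := Nat.gcd (bitsToNat (ym1F z)) v with hg
  rcases Nat.eq_zero_or_pos v with h0 | hpos
  · -- `⟦m⟧ = 0`: then `ym1 = 0`, `g = 0`, both numerals empty
    have hy0 : bitsToNat (ym1F z) = 0 := by omega
    rw [hg, hy0, h0]
    simp [show encodeNat 0 = ([] : List Bool) from rfl]
  · have hgd : g ∣ v := Nat.gcd_dvd_right _ _
    have hg1 : 1 ≤ g := Nat.gcd_pos_of_pos_right _ hpos
    have := size_add_size_div_le hgd hpos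
    rw [TM2Pass.length_encodeNat_eq_size, TM2Pass.length_encodeNat_eq_size]
    have hm : v.size ≤ (mF z).length := by rw [hv, ← length_norm]; exact length_norm_le _
    omega

/-! #### The answers block: the rest and the payload are short -/

/-- The count of the reader never exceeds the number of steps. [folklore] -/
theorem obRun_count_le (a : List Bool) : ∀ k : ℕ, (obRun k a).2.2.1 ≤ k
  | 0 => by simp [obRun]
  | k + 1 => by
    have ih := obRun_count_le a k
    have e : obRun (k + 1) a = obStep (obRun k a) := Function.iterate_succ_apply' obStep k _
    rw [e]
    unfold obStep
    split_ifs <;> simp <;> omega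

/-- `|as'F z| ≤ |asF z|`. [folklore] -/
theorem length_as'F_le (z : List Bool) : (as'F z).length ≤ (asF z).length := by
  have h := (size_obRun (asF z) (mF z).length).1
  simp only [as'F, obF, Function.comp_apply, fanoutFn_apply, takeItemsFn, takeItemsVal, boolUnpair_boolPair, sndF_boolPair]
  omega

/-- `|rOrIdxF z| ≤ |mF z|`. [folklore] -/
theorem length_rOrIdxF_le (z : List Bool) : (rOrIdxF z).length ≤ (mF z).length := by
  have h := (size_obRun (asF z) (mF z).length).2
  have hc := obRun_count_le (asF z) (mF z).length
  simp only [rOrIdxF, obF, Function.comp_apply, fanoutFn_apply, takeItemsFn, takeItemsVal, boolUnpair_boolPair, sndF_boolPair, fstF_boolPair]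
  split_ifs
  · exact (TokConv.length_encodeNat_le _).trans hc
  · exact (length_norm_le _).trans h

/-! #### The divisor and its cofactor are together short -/

/-- For the gcd branch: `|gF z| + |quoF gF z| ≤ |mF z| + 1`. [folklore] -/
theorem length_gF_add_le (z : List Bool) : (gF z).length + (quoF gF z).length ≤ (mF z).length + 1 := by
  have hxl := length_xlF_le z
  have hgF : gF z = encodeNat (Nat.gcd (bitsToNat (xlF z)) (bitsToNat (mF z))) := by simp [gF]
  have hq : quoF gF z = encodeNat (bitsToNat (mF z) / Nat.gcd (bitsToNat (xlF z)) (bitsToNat (mF z))) := by simp [quoF, hgF]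
  rw [hgF, hq]
  set v := bitsToNat (mF z) with hv
  set g := Nat.gcd (bitsToNat (xlF z)) v with hg
  have hm : v.size ≤ (mF z).length := by rw [hv, ← length_norm]; exact length_norm_le _
  rcases Nat.eq_zero_or_pos v with h0 | hpos
  · rw [hg, h0, Nat.gcd_zero_right, Nat.zero_div, show encodeNat 0 = ([] : List Bool) from rfl, List.length_nil, Nat.add_zero]
    exact (length_encodeNat_bitsToNat_le _).trans (by omega)
  · have hgd : g ∣ v := Nat.gcd_dvd_right _ _
    have := size_add_size_div_le hgd hpos
    rw [TM2Pass.length_encodeNat_eq_size, TM2Pass.length_encodeNat_eq_size]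
    omega

/-- For the perfect-power branch (taken only when `ppF` reports a power):
`|base| + |quoF base| ≤ |mF z| + 1`. [folklore] -/
theorem length_ppBase_add_le (z : List Bool) (h : cPP z = [true]) :
    ((sndF ∘ ppDF) z).length + (quoF (sndF ∘ ppDF) z).length ≤ (mF z).length + 1 := by
  have hflag : fstF (ppF (mF z)) = [true] := by simpa [cPP, ppDF] using h
  obtain ⟨r, k, hk, hrk, hbase⟩ := ppF_root_of_flag (mF z) hflag
  have hb : (sndF ∘ ppDF) z = encodeNat r := by simpa [ppDF] using hbase
  have hb' : sndF (ppDF z) = encodeNat r := by simpa [ppDF] using hbase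
  have hq : quoF (sndF ∘ ppDF) z = encodeNat (bitsToNat (mF z) / r) := by simp [quoF, hb']
  rw [hb, hq]
  set v := bitsToNat (mF z) with hv
  have hm : v.size ≤ (mF z).length := by rw [hv, ← length_norm]; exact length_norm_le _
  rcases Nat.eq_zero_or_pos v with h0 | hpos
  · have hr0 : r = 0 := by
      rw [h0] at hrk
      exact pow_eq_zero_iff (by omega) |>.1 hrk
    rw [hr0, h0]
    simp [show encodeNat 0 = ([] : List Bool) from rfl]
  · have hrd : r ∣ v := ⟨r ^ (k - 1), by rw [← pow_succ', Nat.sub_add_cancel (by omega), hrk]⟩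
    have := size_add_size_div_le hrd hpos
    rw [TM2Pass.length_encodeNat_eq_size, TM2Pass.length_encodeNat_eq_size]
    omega

/-- For the even branch: `|twoF z| + |quoF twoF z| ≤ |mF z| + 2`. [folklore] -/
theorem length_twoF_add_le (z : List Bool) : (twoF z).length + (quoF twoF z).length ≤ (mF z).length + 2 := by
  have := length_quoF_le twoF z
  simp only [twoF, List.length_cons, List.length_nil] at this ⊢
  omega

/-- The fresh budget is short: `|budgetF z| ≤ 32 (|xF z| + 1)`. [folklore] -/
theorem length_budgetF_le (z : List Bool) : (budgetF z).length ≤ 32 * ((xF z).length + 1) := by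
  rw [budgetF_eq]
  exact (TokConv.length_encodeNat_le _).trans (by simp [budget])

/-- The decremented budget is not longer. [folklore] -/
theorem length_predF_kF_le (z : List Bool) : (predF (kF z)).length ≤ (kF z).length := by
  rw [predF_apply]
  exact length_encodeNat_le_of_le_bitsToNat (Nat.sub_le _ _)

/-! #### The growth bound -/

/-- `f` grows its argument by at most `C (|x| + 1)` at `z`. [folklore] -/
def Bnd (f : List Bool → List Bool) (C : ℕ) (z : List Bool) : Prop := (f z).length ≤ z.length + C * ((fstF z).length + 1)

/-- Branching: each branch need only be bounded where it is taken. [folklore] -/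
theorem bnd_ite {c f g : List Bool → List Bool} (hc : OneBit c) {C : ℕ} {z : List Bool}
    (hf : c z = [true] → Bnd f C z) (hg : c z = [false] → Bnd g C z) : Bnd (iteFn c f g) C z := by
  obtain ⟨b, hb⟩ := hc z
  cases b
  · unfold Bnd; rw [iteFn_apply_false hb]; exact hg hb
  · unfold Bnd; rw [iteFn_apply_true hb]; exact hf hb

/-- Weakening the constant. [folklore] -/
theorem Bnd.mono {f : List Bool → List Bool} {C D : ℕ} {z : List Bool} (h : Bnd f C z) (hCD : C ≤ D) : Bnd f D z :=
  h.trans (Nat.add_le_add_left (Nat.mul_le_mul_right _ hCD) _)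

/-- `sameR` reassembles: growth `≤ 12`. [folklore] -/
theorem bnd_sameR (z : List Bool) : Bnd sameR 12 z := by
  have hf := length_fields_le z
  unfold Bnd
  rw [sameR, mk7_apply, length_rec7]
  have e : xF z = fstF z := rfl
  rw [← e]
  linarith

/-- `idleR`: growth `≤ 12`. [folklore] -/
theorem bnd_idleR (z : List Bool) : Bnd idleR 12 z := by
  have hf := length_fields_le z
  have hco := length_co'F_le z
  unfold Bnd
  rw [idleR, mk7_apply, length_rec7]
  have e : xF z = fstF z := rfl
  rw [← e]
  linarith

/-- `stuckR`: growth `≤ 26 (|x| + 1)`. [folklore] -/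
theorem bnd_stuckR (z : List Bool) : Bnd stuckR 26 z := by
  have hf := length_fields_le z
  have hco := length_co'F_le z
  have hmr := length_mF_restF_le z
  have hxl := length_xlF_le z
  have hidx := length_rOrIdxF_le z
  have hst : (iteFn cCap (List.cons true ∘ pr (pr xlF mF) rOrIdxF) (fun _ => [true]) z).length ≤ 7 * ((xF z).length + 1) + 7 := by
    obtain ⟨b, hb⟩ := oneBit_cCap z
    cases b
    · rw [iteFn_apply_false hb]; simp
    · rw [iteFn_apply_true hb]
      have hcap : (mF z).length ≤ (xF z).length + 1 := by
        have : cCap z = [decide ((mF z).length ≤ (xF z).length + 1)] := by simp [cCap, lenLeFn_boolPair]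
        rw [this] at hb; simpa using hb
      simp only [Function.comp_apply, fanoutFn_apply, List.length_cons, length_boolPair]
      linarith
  unfold Bnd
  rw [stuckR, mk7_apply, length_rec7]
  have e : xF z = fstF z := rfl
  rw [← e]
  linarith

/-- `failR A`: growth `≤ 20` when `|A z| ≤ |asF z|`. [folklore] -/
theorem bnd_failR {A : List Bool → List Bool} (z : List Bool) (hA : (A z).length ≤ (asF z).length) : Bnd (failR A) 20 z := by
  have hf := length_fields_le z
  have hco := length_co'F_le z
  have hmr := length_mF_restF_le z
  have hkr := length_kF_restBF_le z
  have hpk := length_predF_kF_le z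
  refine bnd_ite oneBit_cLast (fun _ => ?_) (fun _ => ?_)
  · unfold Bnd
    rw [mk7_apply, length_rec7]
    simp only [fanoutFn_apply, length_boolPair, List.length_nil]
    have e : xF z = fstF z := rfl
    rw [← e]
    linarith
  · unfold Bnd
    rw [mk7_apply, length_rec7]
    simp only [fanoutFn_apply, length_boolPair, Function.comp_apply, List.length_nil]
    have e : xF z = fstF z := rfl
    rw [← e]
    linarith

/-- `splitR d A`: growth `≤ 292 (|x| + 1)` when `|A z| ≤ |asF z|` and the divisor with its
cofactor is within `|mF z| + 2`. [folklore] -/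
theorem bnd_splitR {d A : List Bool → List Bool} (z : List Bool) (hA : (A z).length ≤ (asF z).length)
    (hd : (d z).length + (quoF d z).length ≤ (mF z).length + 2) : Bnd (splitR d A) 292 z := by
  have hf := length_fields_le z
  have hco := length_co'F_le z
  have hmr := length_mF_restF_le z
  have hkr := length_kF_restBF_le z
  have hT := length_budgetF_le z
  unfold Bnd
  rw [splitR, mk7_apply, length_rec7]
  simp only [fanoutFn_apply, length_boolPair, List.length_nil]
  have e : xF z = fstF z := rfl
  rw [← e]
  linarith

/-- **Growth of one round**: `|roundF z| ≤ |z| + 300 (|x| + 1)` on every string `z` (with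
`x = fstF z`). [folklore] -/
theorem length_roundF_le (z : List Bool) : (roundF z).length ≤ z.length + 300 * ((fstF z).length + 1) := by
  have hA0 : (asF z).length ≤ (asF z).length := le_rfl
  have hA1 := length_as'F_le z
  have h : Bnd roundF 300 z := by
    refine bnd_ite oneBit_cRun (fun _ => ?_) (fun _ => (bnd_sameR z).mono (by norm_num))
    refine bnd_ite oneBit_cIdle (fun _ => (bnd_idleR z).mono (by norm_num)) (fun _ => ?_)
    refine bnd_ite oneBit_cEven (fun _ => ?_) (fun _ => ?_)
    · exact bnd_ite oneBit_cTwo (fun _ => (bnd_failR z hA0).mono (by norm_num))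
        (fun _ => (bnd_splitR z hA0 (length_twoF_add_le z)).mono (by norm_num))
    refine bnd_ite oneBit_cPP (fun hpp => (bnd_splitR z hA0 ((length_ppBase_add_le z hpp).trans (by omega))).mono (by norm_num))
      (fun _ => ?_)
    refine bnd_ite oneBit_cBad (fun _ => (bnd_failR z hA0).mono (by norm_num)) (fun _ => ?_)
    refine bnd_ite oneBit_cG (fun _ => (bnd_splitR z hA0 ((length_gF_add_le z).trans (by omega))).mono (by norm_num)) (fun _ => ?_)
    refine bnd_ite oneBit_cOk (fun _ => ?_) (fun _ => (bnd_stuckR z).mono (by norm_num))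
    exact bnd_ite oneBit_cShor (fun _ => (bnd_splitR z hA1 ((length_d3F_add_le z).trans (by omega))).mono (by norm_num))
      (fun _ => (bnd_failR z hA1).mono (by norm_num))
  exact h

end Growth

end ShorFP

end Literature.Computability.Cryptography

end
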